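/-
Copyright: statement-level skeleton of a published paper (lit-balaban cell, Phase-2 proof seat p39 gen 8). No proof claims
beyond what the kernel checks below.
-/
import Literature.MathematicalPhysics.QuantumFieldTheory.Balaban1983to89.B3DisplacementWeightedPairSums
import Literature.MathematicalPhysics.QuantumFieldTheory.Balaban1983to89.B3Pi2CxiTorusBounded
import Literature.MathematicalPhysics.QuantumFieldTheory.Balaban1983to89.B3Eq327Cxi
import Literature.MathematicalPhysics.QuantumFieldTheory.Balaban1983to89.B3Pi3CrossTermsZeroTorus

/-!
# B3 — T. Bałaban, *(Higgs)₂,₃ quantum fields in a finite volume. III. Renormalization*, CMP **88** (1983) 411–445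
[Balaban1983Higgs3], p. 442 [PDF 32], the sentence after (3.30): *"where the coefficient at the vertex [Π_{μμ′ν}] is bounded, and
the coefficient at the vertex [Π_{μμ′}] is proportional to (L^{j₀}η)^{−d+2}"* — the `Π_{μμ′ν}` HALF at the zero-field TORUS instance
(`d = 3`): (A) `|Π_{μμ′ν}[C^ξ_T, C^ξ_T](y)| ≤ 3·10¹⁶·|tr q²|·e^{−ξN/8}` for the torus free propagator, uniformly in the spacing
`0 < ξ ≤ 1` and the period `ξN ≥ 1` — the finite-volume defect of the VANISHING (3.27)–(3.28) of the pure-`C^ξ` function on ξℤ³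
(r15's `B3Eq327Cxi.lhs327_Cxi_eq_zero`); (B) hence `|Π^{(ξ)}_{μμ′ν}[G^ξ_k(0), G^ξ_k(0)](y)| ≤ Cst·|tr q²|` for all volumes and all
`1 ≤ k ≤ K` — the RESCALED coefficient at the vertex `Π_{μμ′ν}` is bounded, i.e. (r15's `Pi3_rescale`, factor `(L^{j₀}η)^{−d+3} = 1`)
*"the coefficient at the vertex [Π_{μμ′ν}] is bounded"*

statement-level skeleton of published theorems with citation tags; proofs where landed; nothing here is a claim about
the Yang–Mills mass gap

PDF held: `paper:balaban1983-higgs-2-3-quantum-fields-finite-volume` (journal page = PDF page + 410); pp. 440–442 [PDF 30–32] read on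
the ×2 renders `run/shared/lean/pub/pub-balaban/b2b-balaban-ref1/pages/1983-cmp88-higgs23-III/1983-cmp88-higgs23-III-p030-x2.png` …
`-p032-x2.png`.  Row **B3.Eq3.25-3.32** of `HOME/lit-balaban-r15/ROWS-B3.md` (fold owner r15).  CONTEXT.  On p. 441 the paper writes
the pure-`C^ξ` part of the first-curly-bracket function `Π_{μμ′ν}` of (3.26) on the infinite lattice ξℤ^d and shows by (3.27)–(3.28)
that it VANISHES (`½ tr q² S δ_{μν} − (μ ↔ μ′)` with `S(μ,μ′) ∝ δ_{μμ′}`) — PROVED on ξℤ^d by seat r15 (`B3Eq327Cxi.lhs327_Cxi_eq_zero`,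
with p20's Parseval evaluation of (3.28)).  On the finite torus of the model the displacement `(x′_ν − x_ν)` wraps and the identity
fails verbatim (as (3.29) did, GAPS.md G-B3-08); THIS FILE proves the honest torus statement: the same function with both propagators
equal to the torus free propagator `C^ξ_T` and the printed torus displacement (minimal representative, `B3Taylor310Remainder.disp`) is
EXPONENTIALLY SMALL in the period, uniformly in the spacing — by UNFOLDING the torus `x′`-sum (`B3TorusKernelUnfolding`): the torus
displacement is the wrapped coordinate `ξ·valMinAbs((N·k − w)_ν mod N)` of EVERY unfolded copy, so `Π_{μμ′ν}[C^ξ_T]` is the sum over the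
period shifts `k ∈ ℤ³` of ξℤ³ pair sums with the displacement-weighted kernels `(∂^{ξ*}_μC^ξ)(u)·ξũ_ν`, `(∂^ξ_{μ′}∂^{ξ*}_μC^ξ)(u)·ξũ_ν`
(toolkit `B3DisplacementWeightedPairSums`: one profile power paid by the weight; the second-order kernel needs p20's sharp
all-sites bound `B3CxiAllSitesProfiles`, order `(ξ|u|)^{−3}`); the `k ≠ 0` terms are `O(e^{−ξN|k|_∞/4})`
(`B3Pi2CxiTorusBounded.pair_shift_summable_and_decay`); the `k = 0` term is r15's `lhs327 … 0 = 0` PLUS a boundary layer supported on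
`2|w|_∞ ≥ N` where the wrapped and the true coordinate differ (`B3DisplacementWeightedPairSums.boundary_summable_and_le`, `O(e^{−ξN/4})`).
Combined with seat p39 gen 7's `B3Pi3CrossTermsZeroTorus.Pi3_G0xi_sub_CxiT_disp` (`|Π[G^ξ_k(0)] − Π[C^ξ_T]| ≤ Cst|tr q²|`) this gives
the `Π_{μμ′ν}` half of the quoted sentence at the zero-field torus instance; the `Π_{μμ′}` half is `B3Pi2CxiTorusBounded`.
WHAT IS PROVED (`T = Site P j`, `N = P.sitesPerDir j`, `P.d = 3`, `C^ξ_T = B3CxiTorusBound.CxiT ξ`, `Π = B3Sect3VectorSelfEnergy.Pi3`,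
displacement `dx ν x x′ = B3Taylor310Remainder.disp ξ⁻¹ x x′ ν = ξ·valMinAbs(x′_ν − x_ν)`):
* §1 `wrapDisp_cosetPt`: the printed torus displacement is the wrapped coordinate of every unfolded copy.
* §2 `Pi3_CxiT_eq_tsum`: `Π_{μμ′ν}[C^ξ_T, C^ξ_T](y)` as the sum over the period shifts of the two unfolded weighted pair families
  (`sumA3_unfold`, `sumB3_unfold`; the ξℤ³ weighted-kernel toolkit is `B3DisplacementWeightedPairSums`).
* §3 `zero_shift_term3_eq`: the `k = 0` term is r15's `lhs327 3 ξ τ 0 μ μ′ ν` (`= 0`) plus its boundary layer.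
* §4 **`abs_Pi3_CxiT_le`** (A): `|Π_{μμ′ν}[C^ξ_T, C^ξ_T](y)| ≤ 3·10¹⁶·|τ|·e^{−ξN/8}` for `0 < ξ ≤ 1`, `1 ≤ ξN`, all `μ, μ′, ν, y, τ = tr q²`.
* §5 **`abs_Pi3_G0xi_le`** (B): `∃ Cst` (a function of `L, a, m²`) with `|Π_{μμ′ν}[G^ξ_k(0), G^ξ_k(0)](y)| ≤ Cst·|tr q²|` for every
  `P = (3, L, m, K)`, `1 ≤ k ≤ K`, `μ, μ′, ν, y` (zero-field torus instance `B3GkZeroTorusRescaled.G0xi`, `ξ = L^{−k}` lattice `Site P 0`).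
HONEST SCOPE: zero external field, whole torus, `d = 3`, the printed displacement reading along `Γ_{x,x′}`; the η-lattice factor
`(L^{j₀}η)^{−d+3} = 1` is r15's PROVED rescaling identity `Pi3_rescale` and is not re-derived; (3.30)'s pictures are not typed here.
Mathlib + the cited tree files only; theorems only, no definitions, no named facts; standard axioms.  Unit `lit-balaban-p39-g8`
(Phase-2 proof seat p39, gen 8), HOME `run/shared/lean/pub/lit-balaban/`, 2026-08-21.
-/

open scoped BigOperators

namespace Literature.MathematicalPhysics.QuantumFieldTheory.Balaban1983to89.B3Pi3CxiTorusBounded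

open B3Sect3VectorSelfEnergy B3Sect3ScalarSelfEnergy B3CxiPropagator B3CxiTorusBound B3CxiUniformBound
  B3ZdLatticeProfileSums B3TorusKernelUnfolding B3CxiLatticePairSums B3Pi2CxiTorusBounded B3DisplacementWeightedPairSums
  LatticeFieldCalculus
open B3Taylor310Remainder (steps disp disp_inv)

noncomputable section

variable {P : Params} {j : ℕ} {ξ : ℝ}

/-! ## §1 The printed torus displacement on the unfolded lattice -/

/-- **The printed torus displacement is the wrapped coordinate of every unfolded copy**: for `x′, y ∈ T` and every `m ∈ ℤ^d`,
`ξ·valMinAbs((liftZ x′ y + N·m)_ν mod N) = (x′_ν − y_ν)` (`B3Taylor310Remainder.disp ξ⁻¹ y x′ ν`, the minimal representative in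
physical units — the reading of `(x′_ν − x_ν)` in (3.26) along `Γ_{x,x′}`). [cite: Balaban1983Higgs3, (3.26) p.441] -/
theorem wrapDisp_cosetPt (ξ : ℝ) (y x' : Site P j) (m : ZSite P.d) (ν : Fin P.d) :
    ξ * (((((cosetPt (P.sitesPerDir j) (liftZ x' y) m) ν : ℤ) : ZMod (P.sitesPerDir j)).valMinAbs : ℤ) : ℝ) =
      disp ξ⁻¹ y x' ν := by
  have hc : (((cosetPt (P.sitesPerDir j) (liftZ x' y) m) ν : ℤ) : ZMod (P.sitesPerDir j)) = x' ν - y ν := by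
    rw [cosetPt_apply, Int.cast_add, Int.cast_mul, Int.cast_natCast, ZMod.natCast_self, zero_mul, add_zero, liftZ_cast]
  rw [disp_inv, hc]
  rfl

/-! ## §2 `Π_{μμ′ν}[C^ξ_T, C^ξ_T]` unfolded over the period shifts -/

section Unfold

/-- kernel: signed summability of an unfolded pair family from the absolute one. [cite: Balaban1983Higgs3, (3.27) p.441] -/
private theorem summable_signed₃ (f g : ZSite P.d → ℝ) (N : ℕ)
    (h : Summable fun pr : ZSite P.d × ZSite P.d => |f pr.1| * |g ((N : ℤ) • pr.2 - pr.1)|) :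
    Summable fun pr : ZSite P.d × ZSite P.d => f pr.1 * g ((N : ℤ) • pr.2 - pr.1) :=
  Summable.of_abs (h.congr fun pr => by rw [← abs_mul])

/-- kernel: `(C^ξ_T∂^{ξ*}_μ)(x′,y)·(x′_ν − y_ν) = Σ'_m [(∂^{ξ*}_μC^ξ)·ξ·valMinAbs(·_ν mod N)](liftZ x′ y + N·m)` — the displacement folded
into the periodized kernel. [cite: Balaban1983Higgs3, (3.26) p.441] -/
theorem dAdjKernel_CxiT_mul_disp_eq_tsum (hξ : 0 < ξ) (μ ν : Fin P.d) (x' y : Site P j) :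
    dAdjKernel ξ⁻¹ μ (CxiT ξ) x' y * disp ξ⁻¹ y x' ν =
      ∑' m : ZSite P.d, pdiffAdjZ ξ⁻¹ μ (Cxi P.d ξ) (cosetPt (P.sitesPerDir j) (liftZ x' y) m) *
        (ξ * (((((cosetPt (P.sitesPerDir j) (liftZ x' y) m) ν : ℤ) : ZMod (P.sitesPerDir j)).valMinAbs : ℤ) : ℝ)) := by
  rw [dAdjKernel_CxiT_eq_tsum hξ μ x' y, ← tsum_mul_right]
  exact tsum_congr fun m => by rw [wrapDisp_cosetPt]

/-- kernel: `(∂^ξ_{μ′}C^ξ_T∂^{ξ*}_μ)(x′,y)·(x′_ν − y_ν) = Σ'_m [(∂^ξ_{μ′}∂^{ξ*}_μC^ξ)·ξ·valMinAbs(·_ν mod N)](liftZ x′ y + N·m)`.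
[cite: Balaban1983Higgs3, (3.26) p.441] -/
theorem d2Kernel_CxiT_mul_disp_eq_tsum (hξ : 0 < ξ) (μ' μ ν : Fin P.d) (x' y : Site P j) :
    d2Kernel ξ⁻¹ μ' μ (CxiT ξ) x' y * disp ξ⁻¹ y x' ν =
      ∑' m : ZSite P.d, pdiffZ ξ⁻¹ μ' (pdiffAdjZ ξ⁻¹ μ (Cxi P.d ξ)) (cosetPt (P.sitesPerDir j) (liftZ x' y) m) *
        (ξ * (((((cosetPt (P.sitesPerDir j) (liftZ x' y) m) ν : ℤ) : ZMod (P.sitesPerDir j)).valMinAbs : ℤ) : ℝ)) := by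
  rw [d2Kernel_CxiT_eq_tsum hξ μ' μ x' y, ← tsum_mul_right]
  exact tsum_congr fun m => by rw [wrapDisp_cosetPt]

/-- **The first graph of `Π_{μμ′ν}` unfolded**: `Σ_{x′∈T} (C^ξ_T∂^{ξ*}_{μ′})(y,x′)(C^ξ_T∂^{ξ*}_μ)(x′,y)(x′_ν − y_ν) =
Σ'_kΣ'_w (∂^{ξ*}_{μ′}C^ξ)(w)·(∂^{ξ*}_μC^ξ)(N·k − w)·ξ valMinAbs((N·k − w)_ν mod N)` (`0 < ξ ≤ 1`, `ξN ≥ 1`, `d = 3`).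
[cite: Balaban1983Higgs3, (3.26) p.441] -/
theorem sumA3_unfold (hd : P.d = 3) (hξ : 0 < ξ) (hξ1 : ξ ≤ 1) (hN : 1 ≤ ξ * (P.sitesPerDir j : ℝ)) (μ μ' ν : Fin P.d)
    (y : Site P j) :
    ∑ x' : Site P j, dAdjKernel ξ⁻¹ μ' (CxiT ξ) y x' * (dAdjKernel ξ⁻¹ μ (CxiT ξ) x' y * disp ξ⁻¹ y x' ν) =
      ∑' k : ZSite P.d, ∑' w : ZSite P.d, pdiffAdjZ ξ⁻¹ μ' (Cxi P.d ξ) w *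
        (pdiffAdjZ ξ⁻¹ μ (Cxi P.d ξ) ((P.sitesPerDir j : ℤ) • k - w) *
          (ξ * ((((((P.sitesPerDir j : ℤ) • k - w) ν : ℤ) : ZMod (P.sitesPerDir j)).valMinAbs : ℤ) : ℝ))) := by
  have hg := abs_mul_weight_le_profile hξ (by norm_num : (0 : ℝ) ≤ 900) (q := 1) (pdiffAdjZ ξ⁻¹ μ (Cxi P.d ξ))
    (fun u : ZSite P.d => ξ * ((((u ν : ℤ) : ZMod (P.sitesPerDir j)).valMinAbs : ℤ) : ℝ))
    (abs_pdiffAdjZ_Cxi_le_profile hd hξ hξ1 μ) (abs_wrapDisp_le hξ.le (P.sitesPerDir j) ν)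
  beta_reduce at hg
  have hS := summable_pair_family hd hξ hξ1 hN (by norm_num) (by norm_num) le_rfl (by norm_num : 1 ≤ 2)
    (pdiffAdjZ ξ⁻¹ μ' (Cxi P.d ξ))
    (fun u : ZSite P.d => pdiffAdjZ ξ⁻¹ μ (Cxi P.d ξ) u * (ξ * ((((u ν : ℤ) : ZMod (P.sitesPerDir j)).valMinAbs : ℤ) : ℝ)))
    (abs_pdiffAdjZ_Cxi_le_profile hd hξ hξ1 μ') hg
  have key := sum_tsum_cosetPt_mul_eq_one y (pdiffAdjZ ξ⁻¹ μ' (Cxi P.d ξ))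
    (fun u : ZSite P.d => pdiffAdjZ ξ⁻¹ μ (Cxi P.d ξ) u * (ξ * ((((u ν : ℤ) : ZMod (P.sitesPerDir j)).valMinAbs : ℤ) : ℝ)))
    (summable_signed₃ (pdiffAdjZ ξ⁻¹ μ' (Cxi P.d ξ))
      (fun u : ZSite P.d => pdiffAdjZ ξ⁻¹ μ (Cxi P.d ξ) u * (ξ * ((((u ν : ℤ) : ZMod (P.sitesPerDir j)).valMinAbs : ℤ) : ℝ)))
      (P.sitesPerDir j) hS)
  refine Eq.trans (Finset.sum_congr rfl fun x' _ => ?_) key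
  rw [dAdjKernel_CxiT_mul_disp_eq_tsum hξ μ ν, dAdjKernel_CxiT_eq_tsum hξ μ']

/-- **The second graph of `Π_{μμ′ν}` unfolded**: `Σ_{x′∈T} C^ξ_T(y,x′)(∂^ξ_{μ′}C^ξ_T∂^{ξ*}_μ)(x′,y)(x′_ν − y_ν) =
Σ'_kΣ'_w C^ξ(w)·(∂^ξ_{μ′}∂^{ξ*}_μC^ξ)(N·k − w)·ξ valMinAbs((N·k − w)_ν mod N)`. [cite: Balaban1983Higgs3, (3.26) p.441] -/
theorem sumB3_unfold (hd : P.d = 3) (hξ : 0 < ξ) (hξ1 : ξ ≤ 1) (hN : 1 ≤ ξ * (P.sitesPerDir j : ℝ)) (μ μ' ν : Fin P.d)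
    (y : Site P j) :
    ∑ x' : Site P j, CxiT ξ y x' * (d2Kernel ξ⁻¹ μ' μ (CxiT ξ) x' y * disp ξ⁻¹ y x' ν) =
      ∑' k : ZSite P.d, ∑' w : ZSite P.d, Cxi P.d ξ w *
        (pdiffZ ξ⁻¹ μ' (pdiffAdjZ ξ⁻¹ μ (Cxi P.d ξ)) ((P.sitesPerDir j : ℤ) • k - w) *
          (ξ * ((((((P.sitesPerDir j : ℤ) • k - w) ν : ℤ) : ZMod (P.sitesPerDir j)).valMinAbs : ℤ) : ℝ))) := by
  have hg := abs_mul_weight_le_profile hξ (by norm_num : (0 : ℝ) ≤ 61000) (q := 2)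
    (pdiffZ ξ⁻¹ μ' (pdiffAdjZ ξ⁻¹ μ (Cxi P.d ξ)))
    (fun u : ZSite P.d => ξ * ((((u ν : ℤ) : ZMod (P.sitesPerDir j)).valMinAbs : ℤ) : ℝ))
    (abs_d2Z_Cxi_le_profile hd hξ hξ1 μ' μ) (abs_wrapDisp_le hξ.le (P.sitesPerDir j) ν)
  beta_reduce at hg
  have hS := summable_pair_family hd hξ hξ1 hN (by norm_num) (by norm_num) (by norm_num : 1 ≤ 2) le_rfl (Cxi P.d ξ)
    (fun u : ZSite P.d => pdiffZ ξ⁻¹ μ' (pdiffAdjZ ξ⁻¹ μ (Cxi P.d ξ)) u *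
      (ξ * ((((u ν : ℤ) : ZMod (P.sitesPerDir j)).valMinAbs : ℤ) : ℝ)))
    (abs_Cxi_le_profile hd hξ hξ1) hg
  have key := sum_tsum_cosetPt_mul_eq_one y (Cxi P.d ξ)
    (fun u : ZSite P.d => pdiffZ ξ⁻¹ μ' (pdiffAdjZ ξ⁻¹ μ (Cxi P.d ξ)) u *
      (ξ * ((((u ν : ℤ) : ZMod (P.sitesPerDir j)).valMinAbs : ℤ) : ℝ)))
    (summable_signed₃ (Cxi P.d ξ)
      (fun u : ZSite P.d => pdiffZ ξ⁻¹ μ' (pdiffAdjZ ξ⁻¹ μ (Cxi P.d ξ)) u *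
        (ξ * ((((u ν : ℤ) : ZMod (P.sitesPerDir j)).valMinAbs : ℤ) : ℝ)))
      (P.sitesPerDir j) hS)
  refine Eq.trans (Finset.sum_congr rfl fun x' _ => ?_) key
  rw [d2Kernel_CxiT_mul_disp_eq_tsum hξ μ' μ ν, CxiT_eq_tsum ξ y]

/-- **`Π_{μμ′ν}[C^ξ_T, C^ξ_T]` as the sum over the period shifts** of the two unfolded displacement-weighted pair families (the two
graphs of the first curly bracket of (3.26), printed displacement `(x′_ν − x_ν)`). [cite: Balaban1983Higgs3, (3.26) p.441] -/
theorem Pi3_CxiT_eq_tsum (hd : P.d = 3) (hξ : 0 < ξ) (hξ1 : ξ ≤ 1) (hN : 1 ≤ ξ * (P.sitesPerDir j : ℝ)) (τ : ℝ)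
    (μ μ' ν : Fin P.d) (y : Site P j) :
    Pi3 ξ τ (CxiT ξ) (CxiT ξ) (fun ν x x' => disp ξ⁻¹ x x' ν) μ μ' ν y =
      ξ ^ P.d * (-(τ * ∑' k : ZSite P.d, ∑' w : ZSite P.d, pdiffAdjZ ξ⁻¹ μ' (Cxi P.d ξ) w *
          (pdiffAdjZ ξ⁻¹ μ (Cxi P.d ξ) ((P.sitesPerDir j : ℤ) • k - w) *
            (ξ * ((((((P.sitesPerDir j : ℤ) • k - w) ν : ℤ) : ZMod (P.sitesPerDir j)).valMinAbs : ℤ) : ℝ)))) +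
        τ * ∑' k : ZSite P.d, ∑' w : ZSite P.d, Cxi P.d ξ w *
          (pdiffZ ξ⁻¹ μ' (pdiffAdjZ ξ⁻¹ μ (Cxi P.d ξ)) ((P.sitesPerDir j : ℤ) • k - w) *
            (ξ * ((((((P.sitesPerDir j : ℤ) • k - w) ν : ℤ) : ZMod (P.sitesPerDir j)).valMinAbs : ℤ) : ℝ)))) := by
  have hker : ∀ x', ξ ^ P.d * (kerC ξ τ (CxiT ξ) (CxiT ξ) μ μ' y x' * disp ξ⁻¹ y x' ν) =
      -(ξ ^ P.d * τ) * (dAdjKernel ξ⁻¹ μ' (CxiT ξ) y x' * (dAdjKernel ξ⁻¹ μ (CxiT ξ) x' y * disp ξ⁻¹ y x' ν)) +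
        ξ ^ P.d * τ * (CxiT ξ y x' * (d2Kernel ξ⁻¹ μ' μ (CxiT ξ) x' y * disp ξ⁻¹ y x' ν)) := by
    intro x'; simp only [kerC, kerA, kerB]; ring
  simp only [Pi3]
  rw [Finset.sum_congr rfl fun x' _ => hker x', Finset.sum_add_distrib, ← Finset.mul_sum, ← Finset.mul_sum,
    sumA3_unfold hd hξ hξ1 hN μ μ' ν y, sumB3_unfold hd hξ hξ1 hN μ μ' ν y]
  ring

end Unfold

/-! ## §3 The `k = 0` term on the torus: (3.27) on ξℤ³ plus a boundary layer -/

section ZeroShift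

/-- kernel: `|Σ' f| ≤ Σ' |f|` for a summable real family. [cite: Balaban1983Higgs3, (3.27) p.441] -/
private theorem abs_tsum_le_tsum_abs' {ι : Type*} {f : ι → ℝ} (hf : Summable f) : |∑' i, f i| ≤ ∑' i, |f i| := by
  have h : Summable fun i => ‖f i‖ := hf.abs.congr fun i => (Real.norm_eq_abs _).symm
  rw [← Real.norm_eq_abs]
  exact (norm_tsum_le_tsum_norm h).trans (le_of_eq (tsum_congr fun i => Real.norm_eq_abs _))

/-- **The `k = 0` term of `Π_{μμ′ν}[C^ξ_T]` REDUCES TO ITS BOUNDARY LAYER**: writing the wrapped displacement as `ξ(−w)_ν` plus the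
correction `θ`, the `ξ(−w)_ν`-part is r15's `lhs327 3 ξ τ 0 μ μ′ ν`, which VANISHES by (3.27)–(3.28) (`B3Eq327Cxi.lhs327_Cxi_eq_zero`,
p. 441 *"= ½ tr q² Σ … δ_{μν} − (μ ↔ μ′)"* with (3.28) `∝ δ_{μμ′}`); what remains is the `θ`-part. [cite: Balaban1983Higgs3, (3.27) p.441] -/
theorem zero_shift_term3_eq (hd : P.d = 3) (hξ : 0 < ξ) (hξ1 : ξ ≤ 1) (hN : 1 ≤ ξ * (P.sitesPerDir j : ℝ)) (τ : ℝ)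
    (μ μ' ν : Fin P.d) :
    ξ ^ P.d * (-(τ * ∑' w : ZSite P.d, pdiffAdjZ ξ⁻¹ μ' (Cxi P.d ξ) w *
          (pdiffAdjZ ξ⁻¹ μ (Cxi P.d ξ) ((P.sitesPerDir j : ℤ) • (0 : ZSite P.d) - w) *
            (ξ * ((((((P.sitesPerDir j : ℤ) • (0 : ZSite P.d) - w) ν : ℤ) : ZMod (P.sitesPerDir j)).valMinAbs : ℤ) : ℝ)))) +
        τ * ∑' w : ZSite P.d, Cxi P.d ξ w *
          (pdiffZ ξ⁻¹ μ' (pdiffAdjZ ξ⁻¹ μ (Cxi P.d ξ)) ((P.sitesPerDir j : ℤ) • (0 : ZSite P.d) - w) *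
            (ξ * ((((((P.sitesPerDir j : ℤ) • (0 : ZSite P.d) - w) ν : ℤ) : ZMod (P.sitesPerDir j)).valMinAbs : ℤ) : ℝ)))) =
      ξ ^ P.d * (-(τ * ∑' w : ZSite P.d, pdiffAdjZ ξ⁻¹ μ' (Cxi P.d ξ) w *
          (pdiffAdjZ ξ⁻¹ μ (Cxi P.d ξ) (-w) *
            (ξ * (((((-w) ν : ℤ) : ZMod (P.sitesPerDir j)).valMinAbs : ℤ) : ℝ) - ξ * (((-w) ν : ℤ) : ℝ)))) +
        τ * ∑' w : ZSite P.d, Cxi P.d ξ w *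
          (pdiffZ ξ⁻¹ μ' (pdiffAdjZ ξ⁻¹ μ (Cxi P.d ξ)) (-w) *
            (ξ * (((((-w) ν : ℤ) : ZMod (P.sitesPerDir j)).valMinAbs : ℤ) : ℝ) - ξ * (((-w) ν : ℤ) : ℝ)))) := by
  simp only [smul_zero, zero_sub]
  set N := P.sitesPerDir j with hNdef
  set C := Cxi P.d ξ with hC
  set A := pdiffAdjZ ξ⁻¹ μ C with hA
  set A' := pdiffAdjZ ξ⁻¹ μ' C with hA'
  set E := pdiffZ ξ⁻¹ μ' (pdiffAdjZ ξ⁻¹ μ C) with hE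
  set θ : ZSite P.d → ℝ := fun u => ξ * ((((u ν : ℤ) : ZMod N).valMinAbs : ℤ) : ℝ) - ξ * ((u ν : ℤ) : ℝ) with hθ
  -- summability of the coordinate sections (as in `lhs327_zero_eq`) and of the boundary sections
  have hz : 2 * (0 : ℝ) ≤ (supNorm (0 : ZSite P.d) : ℝ) := by rw [supNorm_zero]; norm_num
  have hfC := abs_Cxi_le_profile hd hξ hξ1
  have hfA := abs_pdiffAdjZ_Cxi_le_profile hd hξ hξ1 μ
  have hfA' := abs_pdiffAdjZ_Cxi_le_profile hd hξ hξ1 μ'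
  have hfE := abs_d2Z_Cxi_le_profile hd hξ hξ1 μ' μ
  have hgA := abs_mul_weight_le_profile hξ (by norm_num : (0 : ℝ) ≤ 900) (q := 1) A (fun u : ZSite P.d => ξ * ((u ν : ℤ) : ℝ))
    hfA (abs_coordDisp_le hξ.le ν)
  have hgE := abs_mul_weight_le_profile hξ (by norm_num : (0 : ℝ) ≤ 61000) (q := 2) E (fun u : ZSite P.d => ξ * ((u ν : ℤ) : ℝ))
    hfE (abs_coordDisp_le hξ.le ν)
  have hsA := (pair_far_bound hd hξ hξ1 (by norm_num) (by norm_num) le_rfl (by norm_num : 1 ≤ 2) A' _ hfA' hgA 0 hz).1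
  have hsB := (pair_far_bound hd hξ hξ1 (by norm_num) (by norm_num) (by norm_num : 1 ≤ 2) le_rfl C _ hfC hgE 0 hz).1
  simp only [zero_sub] at hsA hsB
  have h1 : Summable fun w : ZSite P.d => A' w * (A (-w) * (ξ * (((-w) ν : ℤ) : ℝ))) :=
    Summable.of_abs (hsA.congr fun w => by rw [← abs_mul])
  have h2 : Summable fun w : ZSite P.d => C w * (E (-w) * (ξ * (((-w) ν : ℤ) : ℝ))) :=
    Summable.of_abs (hsB.congr fun w => by rw [← abs_mul])
  have hθ0 : ∀ u : ZSite P.d, 2 * supNorm u < N → θ u = 0 := fun u hu => wrapDisp_sub_coordDisp_eq_zero ξ N ν u hu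
  have hθle : ∀ u : ZSite P.d, |θ u| ≤ 2 * (ξ * (supNorm u : ℝ)) := abs_wrapDisp_sub_coordDisp_le hξ.le N ν
  have hbA := (boundary_summable_and_le hd hξ hξ1 hN (by norm_num) (by norm_num) (by norm_num : 2 + 2 = 4) A' A θ
    hfA' hfA hθ0 hθle).1
  have hbC := (boundary_summable_and_le hd hξ hξ1 hN (by norm_num) (by norm_num) (by norm_num : 1 + 3 = 4) C E θ
    hfC hfE hθ0 hθle).1
  have eA : ∑' w : ZSite P.d, A' w * (A (-w) * (ξ * (((((-w) ν : ℤ) : ZMod N).valMinAbs : ℤ) : ℝ))) =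
      ∑' w : ZSite P.d, A' w * (A (-w) * (ξ * (((-w) ν : ℤ) : ℝ))) + ∑' w : ZSite P.d, A' w * (A (-w) * θ (-w)) := by
    rw [← h1.tsum_add hbA]
    exact tsum_congr fun w => by simp only [hθ]; ring
  have eC : ∑' w : ZSite P.d, C w * (E (-w) * (ξ * (((((-w) ν : ℤ) : ZMod N).valMinAbs : ℤ) : ℝ))) =
      ∑' w : ZSite P.d, C w * (E (-w) * (ξ * (((-w) ν : ℤ) : ℝ))) + ∑' w : ZSite P.d, C w * (E (-w) * θ (-w)) := by
    rw [← h2.tsum_add hbC]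
    exact tsum_congr fun w => by simp only [hθ]; ring
  have h327 : τ * (ξ ^ P.d * (-(∑' w : ZSite P.d, A' w * (A (-w) * (ξ * (((-w) ν : ℤ) : ℝ)))) +
      ∑' w : ZSite P.d, C w * (E (-w) * (ξ * (((-w) ν : ℤ) : ℝ))))) = 0 := by
    rw [← lhs327_zero_eq hd hξ hξ1 τ μ μ' ν]
    exact B3Eq327Cxi.lhs327_Cxi_eq_zero hξ τ 0 μ μ' ν
  rw [eA, eC]
  linear_combination h327

end ZeroShift

/-! ## §4 The pure-`C^ξ_T` function `Π_{μμ′ν}` on the torus -/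

section Main

/-- kernel: `0 < N` and `0 < a = ξN/4`, `1/4 ≤ a`. [cite: Balaban1983Higgs3, (3.27) p.441] -/
private theorem period_rate_pos (hξ : 0 < ξ) (hN : 1 ≤ ξ * (P.sitesPerDir j : ℝ)) :
    (0 : ℝ) < P.sitesPerDir j ∧ 0 < ξ * (P.sitesPerDir j : ℝ) / 4 ∧ 1 / 4 ≤ ξ * (P.sitesPerDir j : ℝ) / 4 := by
  have hNpos : (0 : ℝ) < P.sitesPerDir j := by exact_mod_cast Nat.pos_of_ne_zero (P.sitesPerDir_ne_zero j)
  exact ⟨hNpos, by positivity, by linarith⟩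

/-- **(A) THE PURE-`C^ξ_T` FUNCTION `Π_{μμ′ν}` ON THE TORUS IS EXPONENTIALLY SMALL IN THE PERIOD.**  On the periodic ξ-lattice
`T = Site P j` (`d = 3`, `N` sites per direction) the first-curly-bracket function of (3.26) with BOTH propagators equal to the torus free
propagator `C^ξ_T` and the printed displacement `(x′_ν − x_ν)` (minimal representative along `Γ_{x,x′}`) satisfies
`|Π_{μμ′ν}[C^ξ_T, C^ξ_T](y)| ≤ 3·10¹⁶·|tr q²|·e^{−ξN/8}` for `0 < ξ ≤ 1`, `ξN ≥ 1`, every `y, μ, μ′, ν` — its infinite-lattice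
counterpart is EXACTLY zero by (3.27)–(3.28) (p. 441, r15's `lhs327_Cxi_eq_zero`), which is the coordinate part of the `k = 0` term of
the unfolded torus sum; the bound is the sum of the `k ≠ 0` wrap-around terms and the `k = 0` boundary layer.
[cite: Balaban1983Higgs3, (3.27) p.441] -/
theorem abs_Pi3_CxiT_le (hd : P.d = 3) (hξ : 0 < ξ) (hξ1 : ξ ≤ 1) (hN : 1 ≤ ξ * (P.sitesPerDir j : ℝ)) (τ : ℝ)
    (μ μ' ν : Fin P.d) (y : Site P j) :
    |Pi3 ξ τ (CxiT ξ) (CxiT ξ) (fun ν x x' => disp ξ⁻¹ x x' ν) μ μ' ν y| ≤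
      3 * 10 ^ 16 * |τ| * Real.exp (-(ξ * (P.sitesPerDir j : ℝ) / 8)) := by
  set N := P.sitesPerDir j with hNdef
  set C := Cxi P.d ξ with hC
  set A := pdiffAdjZ ξ⁻¹ μ C with hA
  set A' := pdiffAdjZ ξ⁻¹ μ' C with hA'
  set E := pdiffZ ξ⁻¹ μ' (pdiffAdjZ ξ⁻¹ μ C) with hE
  set wrap : ZSite P.d → ℝ := fun u => ξ * ((((u ν : ℤ) : ZMod N).valMinAbs : ℤ) : ℝ) with hwrap
  set θ : ZSite P.d → ℝ := fun u => ξ * ((((u ν : ℤ) : ZMod N).valMinAbs : ℤ) : ℝ) - ξ * ((u ν : ℤ) : ℝ) with hθ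
  set a : ℝ := ξ * N / 4 with ha
  obtain ⟨hNpos, ha0, ha4⟩ := period_rate_pos hξ hN
  have hξ3 : (0 : ℝ) < ξ ^ 3 := pow_pos hξ 3
  -- the profile bounds of the ξℤ³ kernels and of the weighted ones
  have hfC := abs_Cxi_le_profile hd hξ hξ1
  have hfA := abs_pdiffAdjZ_Cxi_le_profile hd hξ hξ1 μ
  have hfA' := abs_pdiffAdjZ_Cxi_le_profile hd hξ hξ1 μ'
  have hfE := abs_d2Z_Cxi_le_profile hd hξ hξ1 μ' μ
  have hwle : ∀ u : ZSite P.d, |wrap u| ≤ ξ * (supNorm u : ℝ) := abs_wrapDisp_le hξ.le N ν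
  have hgA := abs_mul_weight_le_profile hξ (by norm_num : (0 : ℝ) ≤ 900) (q := 1) A wrap hfA hwle
  have hgE := abs_mul_weight_le_profile hξ (by norm_num : (0 : ℝ) ≤ 61000) (q := 2) E wrap hfE hwle
  have hθ0 : ∀ u : ZSite P.d, 2 * supNorm u < N → θ u = 0 := fun u hu => wrapDisp_sub_coordDisp_eq_zero ξ N ν u hu
  have hθle : ∀ u : ZSite P.d, |θ u| ≤ 2 * (ξ * (supNorm u : ℝ)) := abs_wrapDisp_sub_coordDisp_le hξ.le N ν
  -- the two families over the period shifts
  set aK : ZSite P.d → ℝ := fun k => ∑' w, A' w * (A ((N : ℤ) • k - w) * wrap ((N : ℤ) • k - w)) with haK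
  set bK : ZSite P.d → ℝ := fun k => ∑' w, C w * (E ((N : ℤ) • k - w) * wrap ((N : ℤ) • k - w)) with hbK
  obtain ⟨haKs, hB1⟩ := pair_shift_summable_and_decay hd hξ hξ1 hN (by norm_num) (by norm_num) le_rfl (by norm_num : 1 ≤ 2)
    A' (fun u => A u * wrap u) hfA' hgA
  obtain ⟨hbKs, hB2⟩ := pair_shift_summable_and_decay hd hξ hξ1 hN (by norm_num) (by norm_num) (by norm_num : 1 ≤ 2) le_rfl
    C (fun u => E u * wrap u) hfC hgE
  -- the boundary layers of the k = 0 term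
  obtain ⟨hbAs, hbA⟩ := boundary_summable_and_le hd hξ hξ1 hN (by norm_num) (by norm_num) (by norm_num : 2 + 2 = 4) A' A θ
    hfA' hfA hθ0 hθle
  obtain ⟨hbCs, hbC⟩ := boundary_summable_and_le hd hξ hξ1 hN (by norm_num) (by norm_num) (by norm_num : 1 + 3 = 4) C E θ
    hfC hfE hθ0 hθle
  obtain ⟨-, hExpIte, hIte⟩ := tsum_exp_supNorm_le hd ha0
  -- (1) Π over the period shifts, (2) the k = 0 term reduced to its boundary layer
  rw [Pi3_CxiT_eq_tsum hd hξ hξ1 hN τ μ μ' ν y, haKs.tsum_eq_add_tsum_ite 0, hbKs.tsum_eq_add_tsum_ite 0]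
  have hzero := zero_shift_term3_eq (j := j) hd hξ hξ1 hN τ μ μ' ν
  have hsplit : ξ ^ P.d * (-(τ * (aK 0 + ∑' k, if k = 0 then 0 else aK k)) + τ * (bK 0 + ∑' k, if k = 0 then 0 else bK k)) =
      ξ ^ P.d * (-(τ * aK 0) + τ * bK 0) +
        ξ ^ P.d * (-(τ * ∑' k, if k = 0 then 0 else aK k) + τ * ∑' k, if k = 0 then 0 else bK k) := by ring
  have hξP : ξ ^ P.d = ξ ^ 3 := by rw [hd]
  rw [hsplit, hzero, hξP]
  -- (3) the wrap-around tails
  set S : ℝ := ∑' k : ZSite P.d, (if k = 0 then (0 : ℝ) else Real.exp (-(a * (supNorm k : ℝ)))) with hS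
  have hS0 : 0 ≤ S := tsum_nonneg fun k => by split_ifs <;> positivity
  have hT1 := abs_tsum_ite_le hExpIte hB1
  have hT2 := abs_tsum_ite_le hExpIte hB2
  have hSle : S ≤ 59904 * Real.exp (-(ξ * (N : ℝ) / 8)) := by
    refine hIte.trans ?_
    have h1 : 416 / a ^ 2 ≤ 6656 := by
      rw [div_le_iff₀ (by positivity)]; nlinarith
    have h2 : 1 + 2 / a ≤ 9 := by
      have : 2 / a ≤ 8 := by rw [div_le_iff₀ ha0]; linarith
      linarith
    have h3 : Real.exp (-(a / 2)) = Real.exp (-(ξ * (N : ℝ) / 8)) := by rw [ha]; ring_nf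
    rw [h3]
    have hE := Real.exp_pos (-(ξ * (N : ℝ) / 8))
    calc 416 / a ^ 2 * (1 + 2 / a) * Real.exp (-(ξ * (N : ℝ) / 8)) ≤ 6656 * 9 * Real.exp (-(ξ * (N : ℝ) / 8)) := by
          gcongr
      _ = _ := by norm_num
  have hE48 : Real.exp (-(ξ * (N : ℝ) / 4)) ≤ Real.exp (-(ξ * (N : ℝ) / 8)) := by
    refine Real.exp_le_exp.2 ?_
    have : 0 ≤ ξ * (N : ℝ) := by positivity
    linarith
  have hτ := abs_nonneg τ
  -- the k = 0 boundary layer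
  have p0 : |ξ ^ 3 * (-(τ * ∑' w, A' w * (A (-w) * θ (-w))) + τ * ∑' w, C w * (E (-w) * θ (-w)))| ≤
      |τ| * (26656 * (900 * 900)) * Real.exp (-(ξ * (N : ℝ) / 4)) +
        |τ| * (26656 * (140 * 61000)) * Real.exp (-(ξ * (N : ℝ) / 4)) := by
    rw [abs_mul, abs_of_pos hξ3]
    calc ξ ^ 3 * |-(τ * ∑' w, A' w * (A (-w) * θ (-w))) + τ * ∑' w, C w * (E (-w) * θ (-w))|
        ≤ ξ ^ 3 * (|τ| * |∑' w, A' w * (A (-w) * θ (-w))| + |τ| * |∑' w, C w * (E (-w) * θ (-w))|) := by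
          refine mul_le_mul_of_nonneg_left ((abs_add_le _ _).trans (le_of_eq ?_)) hξ3.le
          rw [abs_neg, abs_mul, abs_mul]
      _ ≤ ξ ^ 3 * (|τ| * ∑' w, |A' w * (A (-w) * θ (-w))| + |τ| * ∑' w, |C w * (E (-w) * θ (-w))|) :=
          mul_le_mul_of_nonneg_left (add_le_add (mul_le_mul_of_nonneg_left (abs_tsum_le_tsum_abs' hbAs) hτ)
            (mul_le_mul_of_nonneg_left (abs_tsum_le_tsum_abs' hbCs) hτ)) hξ3.le
      _ = |τ| * (ξ ^ 3 * ∑' w, |A' w * (A (-w) * θ (-w))|) + |τ| * (ξ ^ 3 * ∑' w, |C w * (E (-w) * θ (-w))|) := by ring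
      _ ≤ |τ| * (26656 * (900 * 900) * Real.exp (-(ξ * (N : ℝ) / 4))) +
            |τ| * (26656 * (140 * 61000) * Real.exp (-(ξ * (N : ℝ) / 4))) :=
          add_le_add (mul_le_mul_of_nonneg_left hbA hτ) (mul_le_mul_of_nonneg_left hbC hτ)
      _ = _ := by ring
  -- the two tails
  have p1 : |ξ ^ 3 * (-(τ * ∑' k, if k = 0 then 0 else aK k) + τ * ∑' k, if k = 0 then 0 else bK k)| ≤
      |τ| * (53312 * (900 * 900)) * S + |τ| * (53312 * (140 * 61000)) * S := by
    rw [abs_mul, abs_of_pos hξ3]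
    have e1 : ∀ c : ℝ, ξ ^ 3 * (|τ| * ((ξ ^ 3)⁻¹ * c * S)) = |τ| * c * S := by
      intro c; field_simp
    calc ξ ^ 3 * |-(τ * ∑' k, if k = 0 then 0 else aK k) + τ * ∑' k, if k = 0 then 0 else bK k|
        ≤ ξ ^ 3 * (|τ| * |∑' k, if k = 0 then 0 else aK k| + |τ| * |∑' k, if k = 0 then 0 else bK k|) := by
          refine mul_le_mul_of_nonneg_left ((abs_add_le _ _).trans (le_of_eq ?_)) hξ3.le
          rw [abs_neg, abs_mul, abs_mul]
      _ ≤ ξ ^ 3 * (|τ| * ((ξ ^ 3)⁻¹ * (53312 * (900 * 900)) * S) + |τ| * ((ξ ^ 3)⁻¹ * (53312 * (140 * 61000)) * S)) :=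
          mul_le_mul_of_nonneg_left (add_le_add (mul_le_mul_of_nonneg_left hT1 hτ) (mul_le_mul_of_nonneg_left hT2 hτ)) hξ3.le
      _ = _ := by rw [mul_add, e1, e1]
  calc |ξ ^ 3 * (-(τ * ∑' w, A' w * (A (-w) * θ (-w))) + τ * ∑' w, C w * (E (-w) * θ (-w))) +
        ξ ^ 3 * (-(τ * ∑' k, if k = 0 then 0 else aK k) + τ * ∑' k, if k = 0 then 0 else bK k)|
      ≤ |ξ ^ 3 * (-(τ * ∑' w, A' w * (A (-w) * θ (-w))) + τ * ∑' w, C w * (E (-w) * θ (-w)))| +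
        |ξ ^ 3 * (-(τ * ∑' k, if k = 0 then 0 else aK k) + τ * ∑' k, if k = 0 then 0 else bK k)| := abs_add_le _ _
    _ ≤ (|τ| * (26656 * (900 * 900)) * Real.exp (-(ξ * (N : ℝ) / 4)) +
          |τ| * (26656 * (140 * 61000)) * Real.exp (-(ξ * (N : ℝ) / 4))) +
        (|τ| * (53312 * (900 * 900)) * S + |τ| * (53312 * (140 * 61000)) * S) := add_le_add p0 p1
    _ = 249233600000 * |τ| * Real.exp (-(ξ * (N : ℝ) / 4)) + 498467200000 * |τ| * S := by ring
    _ ≤ 249233600000 * |τ| * Real.exp (-(ξ * (N : ℝ) / 8)) + 498467200000 * |τ| * (59904 * Real.exp (-(ξ * (N : ℝ) / 8))) := by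
        gcongr
    _ ≤ 3 * 10 ^ 16 * |τ| * Real.exp (-(ξ * (N : ℝ) / 8)) := by
        have hE := (Real.exp_pos (-(ξ * (N : ℝ) / 8))).le
        nlinarith [mul_nonneg hτ hE]

end Main

/-! ## §5 The coefficient at the vertex `Π_{μμ′ν}` for the model propagator -/

/-- **(B) THE RESCALED COEFFICIENT AT THE VERTEX `Π_{μμ′ν}` IS BOUNDED** — p. 442, *"where the coefficient at the vertex [Π_{μμ′ν}]
is bounded"*, at the zero-field torus instance: for odd `L > 1`, `a > 0`, `m² ≥ 0` there is `Cst` (a function of `L, a, m²`) such that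
for EVERY `P = (3, L, m, K)`, `1 ≤ k ≤ K`, `τ = tr q²`, `μ, μ′, ν, y`: `|Π_{μμ′ν}[G^ξ_k(0), G^ξ_k(0)](y)| ≤ Cst·|tr q²|` on the `ξ = L^{−k}`
lattice (`G^ξ_k(0)` = `B3GkZeroTorusRescaled.G0xi`, the rescaled zero-field torus propagator of the print's `G_{j₀}(0)`; the printed
displacement `(x′_ν − x_ν)` along `Γ_{x,x′}`, `B3Taylor310Remainder.disp`), uniformly in the volume and the scale.  By r15's PROVED
rescaling `B3Sect3VectorSelfEnergy.Pi3_rescale` the η-lattice coefficient `Π^{(η,j₀)}_{μμ′ν}` is this bounded function times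
`(L^{j₀}η)^{−d+3} = 1`.  Assembly of seat p39 gen 7's `B3Pi3CrossTermsZeroTorus.Pi3_G0xi_sub_CxiT_disp` (the graphs with at least one
`G(0)(1 − m² − aP)C^ξ` factor are convergent) and (A) `abs_Pi3_CxiT_le`. [cite: Balaban1983Higgs3, (3.30) p.442] -/
theorem abs_Pi3_G0xi_le (L : ℕ) (hL : Odd L ∧ 1 < L) {a : ℝ} (ha : 0 < a) {msq : ℝ} (hmsq : 0 ≤ msq) :
    ∃ Cst : ℝ, 0 < Cst ∧ ∀ (P : Params), P.d = 3 → P.L = L → ∀ k : ℕ, 1 ≤ k → k ≤ P.K →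
      ∀ (τ : ℝ) (μ μ' ν : Fin P.d) (y : Site P 0),
        |Pi3 (P.eta k) τ (B3GkZeroTorusRescaled.G0xi P a msq k) (B3GkZeroTorusRescaled.G0xi P a msq k)
          (fun ν x x' => disp (P.eta k)⁻¹ x x' ν) μ μ' ν y| ≤ Cst * |τ| := by
  obtain ⟨Cst, hCst, H⟩ := B3Pi3CrossTermsZeroTorus.Pi3_G0xi_sub_CxiT_disp L hL ha hmsq
  refine ⟨Cst + 3 * 10 ^ 16, by positivity, fun P hPd hPL k hk1 hkK τ μ μ' ν y => ?_⟩
  have h1 := H P hPd hPL k hk1 hkK τ μ μ' ν y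
  have hkm : k ≤ P.m + P.K := hkK.trans (Nat.le_add_left _ _)
  have hη : 0 < P.eta k := B3GkZeroTorusRescaled.eta_pos P k
  have hη1 : P.eta k ≤ 1 := B3GkZeroTorusRescaled.eta_le_one P k
  have hN : 1 ≤ P.eta k * (P.sitesPerDir 0 : ℝ) := B3GkZeroTorusRescaled.one_le_eta_mul_sitesPerDir P hkm
  have h2 := abs_Pi3_CxiT_le hPd hη hη1 hN τ μ μ' ν y
  have h0 : (0 : ℝ) ≤ P.eta k * (P.sitesPerDir 0 : ℝ) := by positivity
  have h3 : Real.exp (-(P.eta k * (P.sitesPerDir 0 : ℝ) / 8)) ≤ 1 := Real.exp_le_one_iff.2 (by linarith)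
  have hτ := abs_nonneg τ
  set G := B3GkZeroTorusRescaled.G0xi P a msq k with hG
  set D : Fin P.d → Site P 0 → Site P 0 → ℝ := fun ν x x' => disp (P.eta k)⁻¹ x x' ν with hD
  calc |Pi3 (P.eta k) τ G G D μ μ' ν y|
      = |(Pi3 (P.eta k) τ G G D μ μ' ν y - Pi3 (P.eta k) τ (CxiT (P.eta k)) (CxiT (P.eta k)) D μ μ' ν y) +
          Pi3 (P.eta k) τ (CxiT (P.eta k)) (CxiT (P.eta k)) D μ μ' ν y| := by rw [sub_add_cancel]
    _ ≤ |Pi3 (P.eta k) τ G G D μ μ' ν y - Pi3 (P.eta k) τ (CxiT (P.eta k)) (CxiT (P.eta k)) D μ μ' ν y| +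
          |Pi3 (P.eta k) τ (CxiT (P.eta k)) (CxiT (P.eta k)) D μ μ' ν y| := abs_add_le _ _
    _ ≤ Cst * |τ| + 3 * 10 ^ 16 * |τ| * Real.exp (-(P.eta k * (P.sitesPerDir 0 : ℝ) / 8)) := add_le_add h1 h2
    _ ≤ Cst * |τ| + 3 * 10 ^ 16 * |τ| * 1 := by gcongr
    _ = (Cst + 3 * 10 ^ 16) * |τ| := by ring

end

end Literature.MathematicalPhysics.QuantumFieldTheory.Balaban1983to89.B3Pi3CxiTorusBounded
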